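import Summits.CriticalPhenomena.PercolationContinuityZ3.Theorems.PercNearOneGluingNoHeavyLowerTailAntitheticCherryOplus
import Summits.CriticalPhenomena.PercolationContinuityZ3.Theorems.PercNearOneGluingNoHeavyLowerTailAntitheticBlockTools
import HarnessLib

/-!
# `NoHeavyLowerTail` (stmt-CriticalPhenomena-4575) — antithetic cluster pairs: the MIXED SUM (M) at an APEX is termwise nonnegative
# (prim-hp-2 gen 64, HOME/MEMO-gen64.md §3)

Support file (`--supports stmt-CriticalPhenomena-4575`, hull-port prover `prim-hp-2`, gen 64).  No definitions, no named facts, no sorries;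
standard axioms.  VERTEX version; `X_E T = openCluster (T ∩ E) s` (red cluster of `s`), `Y_E T = openCluster (Tᶜ ∩ E) s` (blue cluster);
𝒮 = twisted-monotone super-odd test functions.

An APEX of the edge set `E` is a vertex `Q` joined by a pair of `E` to every other vertex lying on a pair of `E`.
* `Antithetic.Apex.blue_subset_red` — if `Q` is an apex and `Q ∉ Y_E T`, then `Y_E T ⊆ X_E T`: a blue vertex `v ≠ s` and the source both
  see `Q` through pairs that cannot be blue (else `Q` would be blue-reached), so `s – Q – v` is a red path.
* `Antithetic.Apex.mixed_nonneg` — hence the MIXED SUM `Σ_{T : P ∈ X_E T, Q ∉ Y_E T} K₁K₂(X_E T, Y_E T)` is `≥ 0` for all `K₁, K₂ ∈ 𝒮`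
  and every `P` — TERMWISE (`Cherry.zero_cube_nonneg`: a nested pair is a 0-cube).  This is hypothesis (M) of the dual handle theorem
  (…AntitheticHandleDual) for every handle ending at an apex: complete graphs `K_n` (every vertex), wheels (the hub), cones `Q * H` through
  `s`, …; with a ⊕-certificate at `P` it yields Δ2 for `K + handle(P, Q)` (…AntitheticK4Handle).
* (appended) `Antithetic.Apex.blue_subset_red_near`, `mixed_nonneg_near`, `mixed_nonneg_self` — NEAR-APEXES: `Q` need only be joined to the
  vertices other than `s, P, Q`, provided `sQ ∈ E` or `Q = P` (the far pole of `K_{2,k}`, the rim vertex of a wheel opposite to `P`).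
[cite: VandenbergHaggstromKahn2005, §1 p. 3 (open cluster `C_s`)]
-/

noncomputable section

namespace Summit.CriticalPhenomena.PercolationContinuityZ3.Theorems

open Literature.Probability.Percolation
open scoped Classical

namespace Antithetic

namespace Apex

variable {V : Type*} {E : Set (Sym2 V)} {s Q : V} (hQ : ∀ e ∈ E, ∀ v ∈ e, v ≠ Q → s(v, Q) ∈ E)
include hQ

/-- **Blue inside red under an apex.**  `Q` an apex of `E` (joined to every other vertex on a pair of `E`); if `Q` is not in the blue
cluster of `s` then the blue cluster of `s` lies inside the red one. [this work] -/
theorem blue_subset_red (T : Set (Sym2 V)) (hQY : Q ∉ openCluster (Tᶜ ∩ E) s) :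
    openCluster (Tᶜ ∩ E) s ⊆ openCluster (T ∩ E) s := by
  intro v hv
  by_cases hvs : v = s
  · rw [hvs]; exact mem_openCluster_self _ _
  have hv' : (openGraph (Tᶜ ∩ E)).Reachable s v := hv
  have hvQ : v ≠ Q := fun h => hQY (h ▸ hv)
  have hsQ : s ≠ Q := fun h => hQY (h ▸ mem_openCluster_self _ _)
  -- `v` and `s` lie on pairs of `E`, hence are joined to the apex
  obtain ⟨w, hw, -⟩ := Glue.exists_pair_of_reachable (Tᶜ ∩ E) (Ne.symm hvs ∘ Eq.symm) hv'.symm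
  obtain ⟨w', hw', -⟩ := Glue.exists_pair_of_reachable (Tᶜ ∩ E) (fun h => hvs h.symm) hv'
  have hvQE : s(v, Q) ∈ E := hQ _ hw.2 v (Sym2.mem_mk_left _ _) hvQ
  have hsQE : s(s, Q) ∈ E := hQ _ hw'.2 s (Sym2.mem_mk_left _ _) hsQ
  -- both pairs are red: a blue one would put `Q` into the blue cluster
  have hsQT : s(s, Q) ∈ T := by
    by_contra h
    exact hQY (((openGraph_adj (Tᶜ ∩ E) s Q).2 ⟨⟨h, hsQE⟩, hsQ⟩).reachable)
  have hvQT : s(v, Q) ∈ T := by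
    by_contra h
    exact hQY (hv'.trans ((openGraph_adj (Tᶜ ∩ E) v Q).2 ⟨⟨h, hvQE⟩, hvQ⟩).reachable)
  -- the red path `s – Q – v`
  have h1 : (openGraph (T ∩ E)).Adj s Q := (openGraph_adj (T ∩ E) s Q).2 ⟨⟨hsQT, hsQE⟩, hsQ⟩
  have h2 : (openGraph (T ∩ E)).Adj Q v := by
    rw [openGraph_adj, Sym2.eq_swap]
    exact ⟨⟨hvQT, hvQE⟩, hvQ.symm⟩
  exact h1.reachable.trans h2.reachable

variable [Fintype V]

/-- **The mixed sum at an apex is termwise nonnegative**: for `Q` an apex of `E`, every `P`, and all twisted-monotone super-odd `K₁, K₂`,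
`0 ≤ Σ_{T : P ∈ X_E T, Q ∉ Y_E T} K₁ (X_E T) (Y_E T) * K₂ (X_E T) (Y_E T)` (each summand is a nested pair, `Y ⊆ X`). [this work] -/
theorem mixed_nonneg (P : V) (K₁ K₂ : Set V → Set V → ℝ)
    (hK₁ : ∀ ⦃A A' B B' : Set V⦄, A ⊆ A' → B' ⊆ B → K₁ A B ≤ K₁ A' B') (hso₁ : ∀ A B, 0 ≤ K₁ A B + K₁ B A)
    (hK₂ : ∀ ⦃A A' B B' : Set V⦄, A ⊆ A' → B' ⊆ B → K₂ A B ≤ K₂ A' B') (hso₂ : ∀ A B, 0 ≤ K₂ A B + K₂ B A) :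
    0 ≤ ∑ T ∈ Finset.univ.filter (fun T : Set (Sym2 V) => P ∈ openCluster (T ∩ E) s ∧ Q ∉ openCluster (Tᶜ ∩ E) s),
      K₁ (openCluster (T ∩ E) s) (openCluster (Tᶜ ∩ E) s) * K₂ (openCluster (T ∩ E) s) (openCluster (Tᶜ ∩ E) s) := by
  refine Finset.sum_nonneg fun T hT => ?_
  exact Cherry.zero_cube_nonneg _ _ (blue_subset_red hQ T (Finset.mem_filter.1 hT).2.2) hK₁ hso₁ hK₂ hso₂

end Apex

namespace Apex

/-! ### Near-apexes (appended, prim-hp-2 gen 64): the apex may miss the source and the target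

`Q` is a NEAR-APEX for `(E, s, P)` if it is joined to every vertex on a pair of `E` other than `s`, `P`, `Q`.  On the mixed event
`{P ∈ X, Q ∉ Y}` the argument of `blue_subset_red` only needs `Q ∈ X`, which holds when `sQ ∈ E` (the pair is red since `Q ∉ Y`) or when
`Q = P`.  Examples beyond apexes: the far pole of `K_{2,k}` seen from a pole (`P = Q`), the rim vertex of a wheel opposite to `P` (hub = `s`). -/

variable {V : Type*} {E : Set (Sym2 V)} {s P Q : V} (hQ : ∀ e ∈ E, ∀ v ∈ e, v ≠ Q → v ≠ s → v ≠ P → s(v, Q) ∈ E)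
include hQ

/-- **Blue inside red under a near-apex.**  If `Q` is joined to every vertex on a pair of `E` other than `s, P, Q`, then on
`{P ∈ X, Q ∉ Y, Q ∈ X}` the blue cluster of `s` lies inside the red one. [this work] -/
theorem blue_subset_red_near (T : Set (Sym2 V)) (hPX : P ∈ openCluster (T ∩ E) s) (hQY : Q ∉ openCluster (Tᶜ ∩ E) s)
    (hQX : Q ∈ openCluster (T ∩ E) s) : openCluster (Tᶜ ∩ E) s ⊆ openCluster (T ∩ E) s := by
  intro v hv
  by_cases hvs : v = s
  · rw [hvs]; exact mem_openCluster_self _ _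
  by_cases hvP : v = P
  · rw [hvP]; exact hPX
  have hv' : (openGraph (Tᶜ ∩ E)).Reachable s v := hv
  have hvQ : v ≠ Q := fun h => hQY (h ▸ hv)
  obtain ⟨w, hw, -⟩ := Glue.exists_pair_of_reachable (Tᶜ ∩ E) (Ne.symm hvs ∘ Eq.symm) hv'.symm
  have hvQE : s(v, Q) ∈ E := hQ _ hw.2 v (Sym2.mem_mk_left _ _) hvQ hvs hvP
  have hvQT : s(v, Q) ∈ T := by
    by_contra h
    exact hQY (hv'.trans ((openGraph_adj (Tᶜ ∩ E) v Q).2 ⟨⟨h, hvQE⟩, hvQ⟩).reachable)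
  have hQX' : (openGraph (T ∩ E)).Reachable s Q := hQX
  have h2 : (openGraph (T ∩ E)).Adj Q v := by
    rw [openGraph_adj, Sym2.eq_swap]
    exact ⟨⟨hvQT, hvQE⟩, hvQ.symm⟩
  exact hQX'.trans h2.reachable

variable [Fintype V]

/-- **The mixed sum at a near-apex adjacent to the source** is termwise nonnegative: `Q` a near-apex for `(E, s, P)` with `sQ ∈ E`.
[this work] -/
theorem mixed_nonneg_near (hsQ : s(s, Q) ∈ E) (hsQne : s ≠ Q) (K₁ K₂ : Set V → Set V → ℝ)
    (hK₁ : ∀ ⦃A A' B B' : Set V⦄, A ⊆ A' → B' ⊆ B → K₁ A B ≤ K₁ A' B') (hso₁ : ∀ A B, 0 ≤ K₁ A B + K₁ B A)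
    (hK₂ : ∀ ⦃A A' B B' : Set V⦄, A ⊆ A' → B' ⊆ B → K₂ A B ≤ K₂ A' B') (hso₂ : ∀ A B, 0 ≤ K₂ A B + K₂ B A) :
    0 ≤ ∑ T ∈ Finset.univ.filter (fun T : Set (Sym2 V) => P ∈ openCluster (T ∩ E) s ∧ Q ∉ openCluster (Tᶜ ∩ E) s),
      K₁ (openCluster (T ∩ E) s) (openCluster (Tᶜ ∩ E) s) * K₂ (openCluster (T ∩ E) s) (openCluster (Tᶜ ∩ E) s) := by
  refine Finset.sum_nonneg fun T hT => ?_
  obtain ⟨hPX, hQY⟩ := (Finset.mem_filter.1 hT).2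
  -- `sQ` is red (a blue `sQ` would put `Q` into the blue cluster), so `Q ∈ X`
  have hsQT : s(s, Q) ∈ T := by
    by_contra h
    exact hQY (((openGraph_adj (Tᶜ ∩ E) s Q).2 ⟨⟨h, hsQ⟩, hsQne⟩).reachable)
  have hQX : Q ∈ openCluster (T ∩ E) s := ((openGraph_adj (T ∩ E) s Q).2 ⟨⟨hsQT, hsQ⟩, hsQne⟩).reachable
  exact Cherry.zero_cube_nonneg _ _ (blue_subset_red_near hQ T hPX hQY hQX) hK₁ hso₁ hK₂ hso₂

omit hQ in
/-- **The mixed sum `Σ_{P ∈ X, P ∉ Y}` at a near-apex target** (`Q = P`, e.g. the far pole of `K_{2,k}` from a pole) is termwise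
nonnegative. [this work] -/
theorem mixed_nonneg_self (hP : ∀ e ∈ E, ∀ v ∈ e, v ≠ P → v ≠ s → s(v, P) ∈ E) (K₁ K₂ : Set V → Set V → ℝ)
    (hK₁ : ∀ ⦃A A' B B' : Set V⦄, A ⊆ A' → B' ⊆ B → K₁ A B ≤ K₁ A' B') (hso₁ : ∀ A B, 0 ≤ K₁ A B + K₁ B A)
    (hK₂ : ∀ ⦃A A' B B' : Set V⦄, A ⊆ A' → B' ⊆ B → K₂ A B ≤ K₂ A' B') (hso₂ : ∀ A B, 0 ≤ K₂ A B + K₂ B A) :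
    0 ≤ ∑ T ∈ Finset.univ.filter (fun T : Set (Sym2 V) => P ∈ openCluster (T ∩ E) s ∧ P ∉ openCluster (Tᶜ ∩ E) s),
      K₁ (openCluster (T ∩ E) s) (openCluster (Tᶜ ∩ E) s) * K₂ (openCluster (T ∩ E) s) (openCluster (Tᶜ ∩ E) s) := by
  refine Finset.sum_nonneg fun T hT => ?_
  obtain ⟨hPX, hPY⟩ := (Finset.mem_filter.1 hT).2
  refine Cherry.zero_cube_nonneg _ _ (blue_subset_red_near (s := s) (P := P) (Q := P) ?_ T hPX hPY hPX) hK₁ hso₁ hK₂ hso₂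
  intro e he v hv hvP hvs _
  exact hP e he v hv hvP hvs

end Apex

end Antithetic

end Summit.CriticalPhenomena.PercolationContinuityZ3.Theorems
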